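import Summits.Ventures.CertifiedArithmetic.Expansions.EstimateErrorBound
import Mathlib.Tactic.Linarith
import Mathlib.Tactic.Positivity
import Mathlib.Tactic.Ring
import Mathlib.Tactic.NormNum
/-!
# The coupled invariant `|estimate − Σ| + (5/2)·u·|Σ| ≤ 3u·2^s` on class `W`

NEW WORK in the sense of this development (the routine `estimate` of `predicates.c` and the
expansion classes are Shewchuk's; statements and proofs are ours).  `EstimateErrorBound.lean`
proved `|estimate − Σ| ≤ u·2^s` for a NONOVERLAPPING expansion of floats with components `< 2^s`
(`u = 2^−p`), and `EstimateRelativeError.lean` turns the present file into the sharp RELATIVE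
bound `(5/2)·u·|Σ|` on the weakly nonoverlapping class `W` (`IsWeakExpansion`, the class the
expansion algorithms preserve under ties-to-even).  THIS FILE proves, for every `W` expansion of
floats with components `< 2^s` in magnitude (`p ≥ 1`, ANY round-to-nearest, any length, zeros
allowed):
* `abs_estimate_sub_sum_add_le_of_isWeakExpansion` — the COUPLED invariant
  **`|estimate l − Σ l| + (5/2)·u·|Σ l| ≤ 3u·2^s`**: the error budget shrinks linearly as the sum
  approaches the binade boundary (`≤ (u/2)·2^s` at `|Σ| → 2^s`); this is the heart of the
  relative constant `5/2`;
* `IsWeakExpansion.shape_below_top` — the structure of a `W` list under its top component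
  `a = M·2^v` (`M` odd) on which the induction runs: either every earlier component lies below
  `2^(v−1)`, or the list is `l₁ ++ [x₀] ++ zeros ++ [a]` with `|x₀| = 2^(v−1)` and `l₁` below
  `2^(v−2)` (no component of a `W` list is adjacent to two others);
* `abs_estimate_step_le_two_add_u` — the summation step of `EstimateErrorBound` in the form
  `(2 + u)·u·|Σ|` (there it is stated with the rounder constant `3u`).
The companion `EstimateAbsoluteErrorWeak.lean` runs the same induction with the budget
`(6/7)·u·2^s` for the plain absolute error.

PROOF.  Strong induction on the length, peeling the top: the last rounding, of a value `≤ 2^s`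
in magnitude on the grid, costs `≤ (u/2)·2^s`, and `|a| ≤ 2^s − 2^v`.  In the first shape the
induction hypothesis for the prefix at scale `2^(v−1)` gives
`(u/2)·2^s + 3u·2^(v−1) + (5/2)u(2^s − 2^v) = 3u·2^s − u·2^v`.  In the second shape the rounding
of `estimate l₁ + x₀` (magnitude `≤ 2^v`) costs `≤ (u/2)·2^v`, the hypothesis for `l₁` at scale
`2^(v−2)` gives `(3/4)u·2^v − (5/2)u|Σ l₁|`, and `|Σ| ≤ |a| + 2^(v−1) + |Σ l₁|`: the total is
`(u/2)2^s + (1/2 + 3/4 + 5/4 − 5/2)u·2^v + (5/2)u·2^s = 3u·2^s` EXACTLY — no sign analysis is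
needed, and the budget closes with zero slack, which is why `5/2` is the limit of the witnesses.
Every pair `(c, d)` with `|E| + c·u|Σ| ≤ d·u·2^s` provable this way has `d − c ≥ 1/2`;
`(5/2, 3)` is the least pair with `d − c = 1/2`.

EVIDENCE (exhaustive enumeration, engines drafts `estimate_ulp_search/`, class `W`, components
`p`-bit integers below `2^E`, lengths `≤ N`; ties-to-even AND adversarial ties = both directions
explored at every tie): the largest `(|E| + (5/2)u|Σ|)/(u·2^s)` found is `2.9604, 2.9991, 2.9960,
2.9992, 2.9997` at `p = 2, 3, 4, 5, 6` (never above `3`, approaching it).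

CONSEQUENCE.  `EstimateRelativeError.lean` derives **`|estimate − Σ| ≤ (5/2)·u·|Σ|`** on `W`
(`p ≥ 2`), sharp by `EstimateUlpCounterexample` (a family with ratio `5/(2 + 5u)`).  For
Shewchuk's stage-C return test with the PRINTED coefficient `resulterrbound = (3 + 8ε)ε` the
margin condition (MR) `δ < (1 − δ)(1 − ε)³·K_R` holds with `δ = 5ε/2` for every `p ≥ 5`
(`StageBMarginsAttained.resulterrbound_margin_of_le_five_halves`; it fails at `p = 4`, and
with the rounder `3ε` it fails at every precision,
`Orient3dStageCMargins.resulterrbound_margin_three_fails`), so the printed stage-C lines of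
`orient3dadapt` / `incircleadapt` are certified from `p = 5` on (`Orient3dStageCCorrect`,
`IncircleStageCCorrect`).

Reference for the routine and the class: J. R. Shewchuk, Discrete Comput. Geom. 18 (1997)
305–363, §2.7 (`APPROXIMATE`), §4 (error tables) and `predicates.c` [Shewchuk1997].
-/

namespace Summit.Ventures.CertifiedArithmetic.Expansions

open Literature.ComputerArithmetic.JeannerodRump2018
open Literature.ComputerArithmetic.BoldoJeannerodMelquiondMuller2023 hiding twoSum twoSum_fst
  isFloat_twoSum
open Literature.ComputerArithmetic.JoldesMullerPopescu2017 (isFloat_two_zpow abs_fl_le_of_abs_le)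
open Literature.ComputerArithmetic.RumpOgitaOishi2008 (eq_zero_of_isFloat_of_abs_lt)
open Literature.ComputerArithmetic.Shewchuk1997

variable {p : ℕ} {emin : ℤ} {fl : ℚ → ℚ}

/-! ## The summation step with constant `(2 + u)u` -/

/-- ONE SUMMATION STEP IN RELATIVE FORM, SHARP CONSTANT: if the earlier components (a nonoverlapping
expansion of floats) lie below `2^t` and the true total is at least `2^t` in magnitude, then
`|estimate ⊕ a − Σ| ≤ (2 + u)·u·|Σ|` (`p ≥ 1`; `EstimateErrorBound` states the same step with
`3u`). -/
theorem abs_estimate_step_le_two_add_u (hp : 1 ≤ p) (hfl : IsRoundNearest p emin fl)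
    {l : List ℚ} (hFl : ∀ x ∈ l, IsFloat p emin x) (hEl : IsExpansion 1 l) {a : ℚ}
    (hFa : IsFloat p emin a) {t : ℤ} (ht : ∀ x ∈ l, |x| < (2 : ℚ) ^ t)
    (hS : (2 : ℚ) ^ t ≤ |l.sum + a|) :
    |fl (estimate fl l + a) - (l.sum + a)| ≤
      (2 + unitRoundoff p) * unitRoundoff p * |l.sum + a| := by
  have hu0 : 0 ≤ unitRoundoff p := by unfold unitRoundoff; positivity
  have hQF : IsFloat p emin (estimate fl l) := isFloat_estimate hfl hFl
  have hε : |estimate fl l - l.sum| ≤ unitRoundoff p * |l.sum + a| :=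
    (abs_estimate_sub_sum_le_of_isExpansion hp hfl hFl hEl ht).trans
      (mul_le_mul_of_nonneg_left hS hu0)
  have hδ : |estimate fl l + a - fl (estimate fl l + a)| ≤
      unitRoundoff p * |estimate fl l + a| :=
    abs_sub_fl_le_eps_mul_abs hp hfl le_rfl ((OnGrid.of_isFloat hQF).add (OnGrid.of_isFloat hFa))
  have hR : |estimate fl l + a| ≤ |l.sum + a| + |estimate fl l - l.sum| := by
    calc |estimate fl l + a| = |(l.sum + a) + (estimate fl l - l.sum)| := by congr 1; ring
      _ ≤ |l.sum + a| + |estimate fl l - l.sum| := abs_add_le _ _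
  have hδ' : |estimate fl l + a - fl (estimate fl l + a)| ≤
      unitRoundoff p * (|l.sum + a| + unitRoundoff p * |l.sum + a|) :=
    hδ.trans (mul_le_mul_of_nonneg_left (hR.trans (by linarith)) hu0)
  calc |fl (estimate fl l + a) - (l.sum + a)|
      = |-(estimate fl l + a - fl (estimate fl l + a)) + (estimate fl l - l.sum)| := by
        congr 1; ring
    _ ≤ |-(estimate fl l + a - fl (estimate fl l + a))| + |estimate fl l - l.sum| := abs_add_le _ _
    _ = |estimate fl l + a - fl (estimate fl l + a)| + |estimate fl l - l.sum| := by rw [abs_neg]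
    _ ≤ (2 + unitRoundoff p) * unitRoundoff p * |l.sum + a| := by linarith

/-! ## The shape of a `W` list under its top component -/

/-- **THE TWO SHAPES OF A WEAKLY NONOVERLAPPING LIST UNDER ITS TOP.**  If `l ++ [a]` has the `W`
property and `a = M·2^v` with `M` odd, then every component of `l` lies below `2^v`, and EITHER
every component of `l` lies below `2^(v−1)`, OR `l = l₁ ++ x₀ :: l₂` with `|x₀| = 2^(v−1)`
(a one-bit component adjacent to `a`), `l₂` all zeros and every component of `l₁` below
`2^(v−2)` (the `NoDouble` clause: `x₀` is adjacent to `a`, so nothing is adjacent to `x₀`). -/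
theorem IsWeakExpansion.shape_below_top {l : List ℚ} {a : ℚ} {M v : ℤ}
    (hW : IsWeakExpansion (l ++ [a])) (hMo : Odd M) (hav : a = (M : ℚ) * (2 : ℚ) ^ v) :
    (∀ x ∈ l, |x| < (2 : ℚ) ^ v) ∧
      ((∀ x ∈ l, |x| < (2 : ℚ) ^ (v - 1)) ∨
        ∃ l₁ x₀ l₂, l = l₁ ++ x₀ :: l₂ ∧ |x₀| = (2 : ℚ) ^ (v - 1) ∧ (∀ y ∈ l₂, y = 0) ∧
          ∀ y ∈ l₁, |y| < (2 : ℚ) ^ (v - 2)) := by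
  have h2v1 : (0 : ℚ) < (2 : ℚ) ^ (v - 1) := zpow_pos (by norm_num) _
  have e1 : (2 : ℚ) ^ v = 2 * (2 : ℚ) ^ (v - 1) := by
    rw [mul_comm, ← zpow_add_one₀ (by norm_num : (2 : ℚ) ≠ 0), sub_add_cancel]
  have e2 : (2 : ℚ) ^ (v - 1) = 2 * (2 : ℚ) ^ (v - 2) := by
    rw [mul_comm, ← zpow_add_one₀ (by norm_num : (2 : ℚ) ≠ 0)]; ring_nf
  have hWl : IsWeakExpansion l := hW.sublist (List.sublist_append_left l [a])
  have hWa : ∀ x ∈ l, WeakBelow x a := fun x hx =>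
    (List.pairwise_append.mp hW.1).2.2 x hx a (by simp)
  -- every earlier component lies below `2^v`
  have hv : ∀ x ∈ l, |x| < (2 : ℚ) ^ v := fun x hx => by
    obtain ⟨s', hs', hxs'⟩ := (hWa x hx).below_one
    rw [one_mul] at hxs'
    rw [hav] at hs'
    exact lt_of_lt_of_le hxs' (zpow_le_zpow_right₀ (by norm_num) (OnGrid.le_of_odd hMo hs'))
  refine ⟨hv, ?_⟩
  -- the others are `≤ 2^(v-1)`, and `< 2^(v-1)` unless one-bit of that size
  have hsmall : ∀ x ∈ l, |x| < (2 : ℚ) ^ (v - 1) ∨ |x| = (2 : ℚ) ^ (v - 1) := by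
    intro x hx
    rcases hWa x hx with hB2 | ⟨-, e, he⟩
    · left
      obtain ⟨s', hs', hxs'⟩ := hB2
      rw [hav] at hs'
      have : (2 : ℚ) ^ s' ≤ (2 : ℚ) ^ v :=
        zpow_le_zpow_right₀ (by norm_num) (OnGrid.le_of_odd hMo hs')
      linarith
    · have hxv := hv x hx
      rw [he] at hxv
      have hev' : e ≤ v - 1 := by
        by_contra h
        rw [not_le] at h
        have : (2 : ℚ) ^ v ≤ (2 : ℚ) ^ e := zpow_le_zpow_right₀ (by norm_num) (by omega)
        linarith
      rcases lt_or_eq_of_le hev' with hlt | heq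
      · left; rw [he]; exact zpow_lt_zpow_right₀ (by norm_num) hlt
      · right; rw [he, heq]
  by_cases hbig : ∃ x₀ ∈ l, |x₀| = (2 : ℚ) ^ (v - 1)
  swap
  · left
    push Not at hbig
    exact fun x hx => (hsmall x hx).resolve_right (hbig x hx)
  right
  obtain ⟨x₀, hx₀, hx₀abs⟩ := hbig
  obtain ⟨l₁, l₂, rfl⟩ := List.append_of_mem hx₀
  have hx₀0 : x₀ ≠ 0 := by
    intro h; rw [h, abs_zero] at hx₀abs; exact absurd hx₀abs (ne_of_lt h2v1)
  refine ⟨l₁, x₀, l₂, rfl, hx₀abs, ?_, ?_⟩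
  · -- after `x₀` only zeros
    intro y hy
    have hWxy : WeakBelow x₀ y :=
      List.rel_of_pairwise_cons (List.pairwise_append.mp hWl.1).2.1 hy
    obtain ⟨s', hs', hxs'⟩ := hWxy.below_one
    rw [one_mul, hx₀abs] at hxs'
    by_contra hy0
    have h1 : (2 : ℚ) ^ s' ≤ |y| := hs'.two_zpow_le_abs hy0
    have h2 : |y| ≤ (2 : ℚ) ^ (v - 1) := by
      rcases hsmall y (by simp [hy]) with h | h
      · exact h.le
      · exact h.le
    linarith
  · -- before `x₀` everything lies below `2^(v-2)` (no component is adjacent to two others)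
    intro y hy
    have hsub : [y, x₀, a].Sublist (l₁ ++ x₀ :: l₂ ++ [a]) :=
      ((List.singleton_sublist.mpr hy).append
        (List.cons_sublist_cons.mpr (List.nil_sublist l₂))).append (List.Sublist.refl [a])
    have hW3 : IsWeakExpansion [y, x₀, a] := hW.sublist hsub
    have hND : NoDouble y x₀ a :=
      List.rel_of_pairwise_cons (List.triplewise_cons.mp hW3.2).1 (by simp)
    rcases hND with ⟨s', hs', hys'⟩ | ⟨s', hs', hxs'⟩
    · have hs'v : s' ≤ v - 1 := by
        by_contra hlt
        rw [not_le] at hlt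
        have := hs'.two_zpow_le_abs hx₀0
        rw [hx₀abs] at this
        have : (2 : ℚ) ^ (v - 1) < (2 : ℚ) ^ s' := zpow_lt_zpow_right₀ (by norm_num) hlt
        linarith
      have : (2 : ℚ) ^ s' ≤ (2 : ℚ) ^ (v - 1) := zpow_le_zpow_right₀ (by norm_num) hs'v
      linarith
    · exfalso
      rw [hav] at hs'
      have : (2 : ℚ) ^ s' ≤ (2 : ℚ) ^ v :=
        zpow_le_zpow_right₀ (by norm_num) (OnGrid.le_of_odd hMo hs')
      rw [hx₀abs] at hxs'
      linarith

/-- The top of a list of floats below `2^s`, written `a = M·2^v` with `M` odd, satisfies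
`2^v ≤ |a| ≤ 2^s − 2^v` (both `a` and `2^s` are multiples of `2^v`), and the last rounding of
`estimate` — of a value `≤ 2^s` in magnitude on the grid — costs at most `(u/2)·2^s`. -/
theorem abs_fl_estimate_add_sub_le_of_odd_top (hp : 1 ≤ p) (hfl : IsRoundNearest p emin fl)
    {l : List ℚ} (hFl : ∀ x ∈ l, IsFloat p emin x) (hEl : IsExpansion 1 l) {a : ℚ}
    (hFa : IsFloat p emin a) {M v s : ℤ} (hMo : Odd M) (hav : a = (M : ℚ) * (2 : ℚ) ^ v)
    (hv : ∀ x ∈ l, |x| < (2 : ℚ) ^ v) (hsa : |a| < (2 : ℚ) ^ s) :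
    (2 : ℚ) ^ v ≤ |a| ∧ |a| ≤ (2 : ℚ) ^ s - (2 : ℚ) ^ v ∧
      |fl (estimate fl l + a) - (estimate fl l + a)| ≤ unitRoundoff p / 2 * (2 : ℚ) ^ s := by
  have h2v : (0 : ℚ) < (2 : ℚ) ^ v := zpow_pos (by norm_num) _
  have hQF : IsFloat p emin (estimate fl l) := isFloat_estimate hfl hFl
  have hQv : |estimate fl l| ≤ (2 : ℚ) ^ v := abs_estimate_le_two_zpow hp hfl hFl hEl hv
  have hM0 : M ≠ 0 := by rintro rfl; obtain ⟨k, hk⟩ := hMo; omega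
  have hM1 : (1 : ℤ) ≤ |M| := Int.one_le_abs hM0
  have hM1' : (1 : ℚ) ≤ |(M : ℚ)| := by rw [← Int.cast_abs]; exact_mod_cast hM1
  have habs : |a| = |(M : ℚ)| * (2 : ℚ) ^ v := by rw [hav, abs_mul, abs_of_pos h2v]
  have hva : (2 : ℚ) ^ v ≤ |a| := by rw [habs]; exact le_mul_of_one_le_left h2v.le hM1'
  have hvs : v < s :=
    (zpow_lt_zpow_iff_right₀ (by norm_num : (1 : ℚ) < 2)).mp (hva.trans_lt hsa)
  -- `a` and `2^s` are multiples of `2^v`, so `|a| ≤ 2^s - 2^v` and `|estimate l + a| ≤ 2^s`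
  have haG : OnGrid v a := ⟨M, hav⟩
  have hsG : OnGrid v ((2 : ℚ) ^ s) := OnGrid.two_zpow hvs.le
  have hup : a + (2 : ℚ) ^ v ≤ (2 : ℚ) ^ s := haG.add_two_zpow_le hsG (lt_of_abs_lt hsa)
  have hlo : -(2 : ℚ) ^ s + (2 : ℚ) ^ v ≤ a :=
    hsG.neg.add_two_zpow_le haG (neg_lt_of_abs_lt hsa)
  have hQa : |estimate fl l + a| ≤ (2 : ℚ) ^ s := by
    obtain ⟨hQ1, hQ2⟩ := abs_le.mp hQv
    rw [abs_le]; constructor <;> linarith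
  exact ⟨hva, abs_le.mpr ⟨by linarith, by linarith⟩,
    abs_fl_sub_le_half_u_two_zpow hp hfl ((OnGrid.of_isFloat hQF).add (OnGrid.of_isFloat hFa)) hQa⟩

/-! ## The coupled invariant `|estimate − Σ| + (5/2)·u·|Σ| ≤ 3u·2^s` -/

set_option maxHeartbeats 800000 in
/-- **`|estimate − Σ| + (5/2)·u·|Σ| ≤ 3u·2^s` ON WEAKLY NONOVERLAPPING EXPANSIONS** with
components `< 2^s` in magnitude (`p ≥ 1`, any round-to-nearest `fl` into `F(p, emin)`, any
length, zeros allowed).  Equivalently `|estimate − Σ| ≤ (u/2)·2^s + (5/2)·u·(2^s − |Σ|)`: half an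
ulp of the enclosing binade plus `5/2·u` times the headroom.  The budget closes with zero slack in
the second shape of `IsWeakExpansion.shape_below_top` (module docstring). -/
theorem abs_estimate_sub_sum_add_le_of_isWeakExpansion (hp : 1 ≤ p)
    (hfl : IsRoundNearest p emin fl) :
    ∀ {l : List ℚ}, (∀ x ∈ l, IsFloat p emin x) → IsWeakExpansion l →
      ∀ {s : ℤ}, (∀ x ∈ l, |x| < (2 : ℚ) ^ s) →
        |estimate fl l - l.sum| + 5 / 2 * unitRoundoff p * |l.sum| ≤
          3 * unitRoundoff p * (2 : ℚ) ^ s := by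
  have hu0 : 0 ≤ unitRoundoff p := by unfold unitRoundoff; positivity
  -- strong induction on the length (the second shape recurses into a proper prefix of the prefix)
  suffices H : ∀ n : ℕ, ∀ {l : List ℚ}, l.length ≤ n → (∀ x ∈ l, IsFloat p emin x) →
      IsWeakExpansion l → ∀ {s : ℤ}, (∀ x ∈ l, |x| < (2 : ℚ) ^ s) →
        |estimate fl l - l.sum| + 5 / 2 * unitRoundoff p * |l.sum| ≤
          3 * unitRoundoff p * (2 : ℚ) ^ s by
    intro l hF hW s hs; exact H l.length le_rfl hF hW hs
  have hnil : ∀ s : ℤ, |estimate fl [] - ([] : List ℚ).sum| +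
      5 / 2 * unitRoundoff p * |([] : List ℚ).sum| ≤ 3 * unitRoundoff p * (2 : ℚ) ^ s := by
    intro s
    rw [show estimate fl [] = 0 from rfl, List.sum_nil, sub_zero, abs_zero, mul_zero, add_zero]
    exact mul_nonneg (mul_nonneg (by norm_num) hu0) (zpow_nonneg (by norm_num) _)
  intro n
  induction n with
  | zero =>
    intro l hl _ _ s _
    rw [List.eq_nil_of_length_eq_zero (Nat.le_zero.mp hl)]
    exact hnil s
  | succ n ih =>
    intro l hl hF hW s hs
    rcases l.eq_nil_or_concat with rfl | ⟨l, a, rfl⟩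
    · exact hnil s
    simp only [List.concat_eq_append] at hl hF hW hs ⊢
    have hln : l.length ≤ n := by simp at hl; omega
    have hFl : ∀ x ∈ l, IsFloat p emin x := fun x hx => hF x (by simp [hx])
    have hFa : IsFloat p emin a := hF a (by simp)
    have hWl : IsWeakExpansion l := hW.sublist (List.sublist_append_left l [a])
    have hEl : IsExpansion 1 l := hWl.isExpansion
    have hsl : ∀ x ∈ l, |x| < (2 : ℚ) ^ s := fun x hx => hs x (by simp [hx])
    have hsa : |a| < (2 : ℚ) ^ s := hs a (by simp)
    have h2s : (0 : ℚ) < (2 : ℚ) ^ s := zpow_pos (by norm_num) _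
    have hus : 0 ≤ unitRoundoff p * (2 : ℚ) ^ s := mul_nonneg hu0 h2s.le
    rw [List.sum_append, List.sum_singleton]
    by_cases hl0 : l = []
    · subst hl0
      rw [show estimate fl ([] ++ [a]) = a from rfl, List.sum_nil, zero_add, sub_self, abs_zero]
      have := mul_le_mul_of_nonneg_left hsa.le hu0
      linarith
    rw [estimate_append_singleton fl hl0]
    have hQF : IsFloat p emin (estimate fl l) := isFloat_estimate hfl hFl
    by_cases ha0 : a = 0
    · rw [ha0, add_zero, add_zero, fl_eq_self hfl hQF]; exact ih hln hFl hWl hsl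
    obtain ⟨M, v, hMo, -, -, hav⟩ := exists_odd_mul_two_zpow hFa ha0
    obtain ⟨hv, hshape⟩ := IsWeakExpansion.shape_below_top hW hMo hav
    obtain ⟨-, haabs, hδ⟩ :=
      abs_fl_estimate_add_sub_le_of_odd_top hp hfl hFl hEl hFa hMo hav hv hsa
    have h2v1 : (0 : ℚ) < (2 : ℚ) ^ (v - 1) := zpow_pos (by norm_num) _
    have h2v2 : (0 : ℚ) < (2 : ℚ) ^ (v - 2) := zpow_pos (by norm_num) _
    have hX : 0 ≤ unitRoundoff p * (2 : ℚ) ^ (v - 2) := mul_nonneg hu0 h2v2.le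
    have e1 : (2 : ℚ) ^ v = 2 * (2 : ℚ) ^ (v - 1) := by
      rw [mul_comm, ← zpow_add_one₀ (by norm_num : (2 : ℚ) ≠ 0), sub_add_cancel]
    have e2 : (2 : ℚ) ^ (v - 1) = 2 * (2 : ℚ) ^ (v - 2) := by
      rw [mul_comm, ← zpow_add_one₀ (by norm_num : (2 : ℚ) ≠ 0)]; ring_nf
    have hua := mul_le_mul_of_nonneg_left haabs hu0
    -- it remains to bound `|E'| + (5/2)u|Σ'|` for the prefix by `(5/2)·u·2^v`
    suffices hE : |estimate fl l - l.sum| + 5 / 2 * unitRoundoff p * |l.sum| ≤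
        5 / 2 * unitRoundoff p * (2 : ℚ) ^ v by
      have htri : |fl (estimate fl l + a) - (l.sum + a)| ≤
          |fl (estimate fl l + a) - (estimate fl l + a)| + |estimate fl l - l.sum| := by
        calc |fl (estimate fl l + a) - (l.sum + a)|
            = |(fl (estimate fl l + a) - (estimate fl l + a)) + (estimate fl l - l.sum)| := by
              congr 1; ring
          _ ≤ _ := abs_add_le _ _
      have hSa := mul_le_mul_of_nonneg_left (abs_add_le l.sum a) hu0
      rw [mul_add] at hSa
      linarith
    rcases hshape with hv1 | ⟨l₁, x₀, l₂, rfl, hx₀abs, hl₂, hl₁⟩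
    · -- first shape: the prefix lies below `2^(v-1)`: `3u·2^(v-1) ≤ (5/2)u·2^v`
      have hIH := ih hln hFl hWl hv1
      rw [e1, e2] at *
      linarith
    -- second shape: `l = l₁ ++ [x₀] ++ zeros`, `|x₀| = 2^(v-1)`, `l₁` below `2^(v-2)`
    have hF₁ : ∀ y ∈ l₁, IsFloat p emin y := fun y hy => hFl y (by simp [hy])
    have hFx₀ : IsFloat p emin x₀ := hFl x₀ (by simp)
    have hW₁ : IsWeakExpansion l₁ := hWl.sublist (List.sublist_append_left l₁ (x₀ :: l₂))
    have hE₁ : IsExpansion 1 l₁ := hW₁.isExpansion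
    have hln₁ : l₁.length ≤ n := le_trans (by simp) hln
    -- the sum and the running value only see `l₁ ++ [x₀]`
    have hS : (l₁ ++ x₀ :: l₂).sum = l₁.sum + x₀ := by
      rw [List.sum_append, List.sum_cons, List.sum_eq_zero hl₂, add_zero]
    have hQeq : estimate fl (l₁ ++ x₀ :: l₂) = estimate fl (l₁ ++ [x₀]) := by
      rw [show l₁ ++ x₀ :: l₂ = (l₁ ++ [x₀]) ++ l₂ by simp]
      exact estimate_append_of_forall_eq_zero hfl (by simp)
        (fun y hy => by
          rcases List.mem_append.mp hy with h | h
          · exact hF₁ y h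
          · rw [List.mem_singleton.mp h]; exact hFx₀) hl₂
    rw [hS, hQeq]
    by_cases hl₁0 : l₁ = []
    · subst hl₁0
      rw [show estimate fl ([] ++ [x₀]) = x₀ from rfl, List.sum_nil, zero_add, sub_self, abs_zero,
        hx₀abs, e1, e2]
      linarith
    rw [estimate_append_singleton fl hl₁0]
    -- `Q₁ = estimate l₁`: hypothesis at scale `2^(v-2)`; rounding `Q₁ + x₀` (`≤ 2^v`): `(u/2)·2^v`
    have hQ₁F : IsFloat p emin (estimate fl l₁) := isFloat_estimate hfl hF₁
    have hQ₁ : |estimate fl l₁| ≤ (2 : ℚ) ^ (v - 2) := abs_estimate_le_two_zpow hp hfl hF₁ hE₁ hl₁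
    have hIH₁ := ih hln₁ hF₁ hW₁ hl₁
    have hTG : OnGrid emin (estimate fl l₁ + x₀) :=
      (OnGrid.of_isFloat hQ₁F).add (OnGrid.of_isFloat hFx₀)
    have hTv : |estimate fl l₁ + x₀| ≤ (2 : ℚ) ^ v := by
      have := abs_add_le (estimate fl l₁) x₀
      rw [hx₀abs] at this
      linarith
    have hδ₂ := abs_fl_sub_le_half_u_two_zpow hp hfl hTG hTv
    have htri : |fl (estimate fl l₁ + x₀) - (l₁.sum + x₀)| ≤
        |fl (estimate fl l₁ + x₀) - (estimate fl l₁ + x₀)| + |estimate fl l₁ - l₁.sum| := by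
      calc |fl (estimate fl l₁ + x₀) - (l₁.sum + x₀)|
          = |(fl (estimate fl l₁ + x₀) - (estimate fl l₁ + x₀)) + (estimate fl l₁ - l₁.sum)| := by
            congr 1; ring
        _ ≤ _ := abs_add_le _ _
    have hSx := mul_le_mul_of_nonneg_left (abs_add_le l₁.sum x₀) hu0
    rw [mul_add, hx₀abs] at hSx
    rw [e1, e2] at *
    linarith

end Summit.Ventures.CertifiedArithmetic.Expansions
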